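import Summits.Schanuel.Schanuel.Theorems.DiophantineDichotomyApproximationPropertyPointAPThreeEnvelope
import Summits.Schanuel.Schanuel.Theorems.DiophantineDichotomyApproximationPropertyOrbitClusterBoundDeficient
import Summits.Schanuel.Schanuel.Theorems.DiophantineDichotomyApproximationPropertyDeficientLeverEmbeddingKit
import Summits.Schanuel.Schanuel.Theorems.DiophantineDichotomyApproximationPropertyDeficientLeverJensen
import Summits.Schanuel.Schanuel.Theorems.DiophantineDichotomyApproximationPropertyZeroDimDictionaryDeficient
import Summits.Schanuel.Schanuel.Theorems.DiophantineDichotomyApproximationPropertySharpClosestPointDeficient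
import Summits.Schanuel.Schanuel.Theorems.DiophantineDichotomyApproximationPropertyPointDatumOfNearClause
import HarnessLib

/-!
# `PointAPAbsAt 3` and the `t = 3` slice of the crux, CONDITIONALLY on ONE statement: the far DEFICIENT satellite kernel (crux `ApproximationProperty`, stmt-Schanuel-6117)

Crux `stmt-Schanuel-6117` (`Summit.Schanuel.Schanuel.Theses.DiophantineDichotomy.ApproximationProperty`),
route `DiophantineDichotomy`, line `orbit-interpolation-determinant`, leads c8/c9
(`prover-line-stmt-Schanuel-6117-c8-0` designed skeleton v21, `prover-line-stmt-Schanuel-6117-c9-0` lands it as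
v23, `Cruxes/ApproximationProperty/Lines/orbit_interpolation_determinant.lean`).

This file LANDS, as real theorems with ONE explicit hypothesis (no `sorry`, no new definition, no
named fact), the kernel-checked `t = 3` content of skeleton v21–v23 — the successor of
…PointAPThreeEnvelope.lean (p137055, hypothesis `hfarEnv` = thin ∧ far ∧ enveloped satellite). What
changed: the DEFICIENT-RANK lever is now a theorem of the tree — `orbitClusterBoundDeficient_of`
(…OrbitClusterBoundDeficient.lean, p140229: interpolation determinant on a maximal non-singular minor,
norm through a Galois hull, fibrewise averaging + Jensen) over the number-field kit `embedding_kit`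
(p137492) and `jensen_rpow_gain` (p137371), with its dictionary clause `stub_zeroDimDictionaryDeficient`
(p138085), the sharp closest point under the near-clause `sharpClosestPointDeficient_of` (p138052) and the
near-clause transfer `pointDatum_of_nearClause` (p138060). Hence an orbit imposing at least `deg 𝔭 / K₀`
conditions on the forms of degree `⌊C₄Δ⌋` is GOOD for every constant `K₀`, and the far hypothesis shrinks
to `hfarDef` (= registered stub `pointDatum_of_farSatellite3_def` verbatim): a long orbit of the thin
clause-free descent failing the clause at `⌊c₁Δ⌋`, lying on a THIN satellite `𝔮'` of degree `> δ⋆`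
(minimal prime of `(Q, P)` containing `T`, `𝔮' < 𝔭`) which ENVELOPS it at level `⌊C₄Δ⌋`
(`ℚ[x]_{⌊C₄Δ⌋} ∩ 𝔭 ⊆ 𝔮'`) and on whose forms of degree `⌊C₄Δ⌋` the orbit imposes FEWER than `deg 𝔭 / K₀`
conditions (`K₀·dim ℚ[x]_{⌊C₄Δ⌋} < deg 𝔭 + K₀·dim(ℚ[x]_{⌊C₄Δ⌋} ∩ 𝔭)`), the constants `δ⋆, K₀, C₄ ≥ c₁, λ, c`
being at the hypothesis' disposal. Case tree of the transfer (`pointDatum_of_datum3_of_farDef`): (G) clause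
at `⌊c₁Δ⌋` ⇒ landed good transfer; (N) near-clause at `⌊C₄Δ⌋` ⇒ `pointDatum_of_nearClause`; else
`fourthForm_or_enveloped` (p136444): (CP4) a fourth form ⇒ Chardin–Philippon with `k = 4`
(`clause_of_fourthForm`) ⇒ good; (ENV) line satellite ⇒ `pointDatum_of_lineSatellite3_log`; bounded
degree ⇒ `pointDatum_of_boundedSatellite3`; far ⇒ `hfarDef`.
So `PointAPAbsAt 3` — hence the approximation property for every `θ ∈ ℂ^ι` with `trdeg_ℚ ℚ(θ) ≤ 3`
(`PointwiseAPSlice 3`, NOT in print: LNM 1752 Ch. 4 §4 p. 61 has AP2 for `n ≤ 2` only) — follows from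
`hfarDef` ALONE, and the whole crux from `hfarDef` and `PointAPAbsAt t` for `t ≥ 4` (Philippon's
conjecture). `hfarDef` is implied by `PointAPAbsAt 3` itself (ignore its hypotheses), so it is exactly the
open residual of the `t = 3` slice in this line (≈ Philippon's AP2 at `n = 3` in the configuration of
`Cruxes/ApproximationProperty/KERNEL-c8.md` §5 / `KERNEL-c9.md`).

Main results: `sharpClosestPointDeficient` (the deficient sharp closest-point property, unconditional),
`pointDatum_of_datum3_of_farDef`, `pointAPAt3_of_farDef`, `slice_three_of_farDef` and
`approximationProperty_of_farDef` (registered sub-goals of the crux item), `pointAP_three_le_of_farDef`.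

Sources: NesterenkoPhilippon2001 (LNM 1752) Ch. 3 §4, Ch. 4 §4 p. 61 (AP1 ⇒ AP2 scheme, AP2 proved
for `n ≤ 2` only); Philippon2000; ChardinPhilippon1999; LaurentRoy1999 (interpolation determinants).
-/

set_option linter.dupNamespace false

namespace Summit.Schanuel.Schanuel.Cruxes.ApproximationProperty.OrbitInterpolationDeterminant

open Summit.Schanuel.Schanuel.Theses.DiophantineDichotomy
open Literature.NumberTheory.Transcendental.Nesterenko MvPolynomial
open scoped BigOperators

attribute [local instance] MvPolynomial.gradedAlgebra

noncomputable section

open PointAPThreeConditional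

/-- **The deficient sharp closest-point property, UNCONDITIONAL**: composed from the landed
deficient-rank lever `orbitClusterBoundDeficient_of` (p140229) over the number-field kit
`embedding_kit` (p137492) and the convexity step `jensen_rpow_gain` (p137371), and the landed
`sharpClosestPointDeficient_of` (p138052), `stub_zeroDimDictionaryDeficient` (p138085).
[cite: NesterenkoPhilippon2001, Ch. 3 Prop. 4.13; LaurentRoy1999] -/
theorem sharpClosestPointDeficient : SharpClosestPointDeficient :=
  sharpClosestPointDeficient_of (orbitClusterBoundDeficient_of embedding_kit jensen_rpow_gain)
    stub_zeroDimDictionaryDeficient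

/-! ## The `t = 3` transfer from a descent datum, conditionally on the far deficient kernel -/

/-- **The point datum from ANY datum of the thin clause-free descent, given the far deficient kernel
`hfarDef`** (skeleton v21–v23's `pointDatum_of_datum3` with its one open stub as a hypothesis): for every
`ω` and `c₁ ≥ 1` there are `λ ≥ 1`, `c ≥ c₁` such that a `CycleAP3Datum` at the boosted scale `(Δ, λY)`
with constant `c₁` whose third cut certifies thin satellites yields a point datum at `(Δ, Y)` with
constant `c`. Case tree: (G) the clause for `𝔭` at level `⌊c₁Δ⌋` ⇒ the landed per-scale transfer
`pointDatum_of_clause` at the constant `c₁g = max c₁ (C₄ + 24)`, after `clause_mono_level`; (¬G) the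
orbit is long (`rankOne_interpolation_of_ideg_le`); (N) the NEAR-clause at `⌊C₄Δ⌋` ⇒ the deficient
lever's transfer `pointDatum_of_nearClause` over `sharpClosestPointDeficient`; (¬N) the orbit is
`K₀`-deficient, and `fourthForm_or_enveloped` at level `ν₄ = ⌊C₄Δ⌋` splits: (CP4) a form `g ∈ 𝔭` of
degree `ν₄` with `𝔭` minimal over `(Q, P, T, g)` ⇒ Chardin–Philippon with `k = 4`
(`clause_of_fourthForm`) ⇒ clause at `⌊c₁g Δ⌋ ≥ a + b + τ + ν₄ − 2` ⇒ transfer; (ENV) a satellite `𝔮'`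
enveloping the orbit: (L) degree `1` ⇒ `pointDatum_of_lineSatellite3_log`; (B) degree `≤ δ⋆` ⇒
`pointDatum_of_boundedSatellite3`; (F) degree `> δ⋆` ⇒ `hfarDef` (consulted FIRST: it fixes
`δ⋆, K₀, C₄, λ_f, c_f`). The five boosts are multiplied and each branch's datum at `(Δ, λ'Y)` is a
datum at `(Δ, Y)` by `datum_mono`.
[cite: NesterenkoPhilippon2001, Ch. 4 §4 p. 61 (AP1 ⇒ AP2 scheme); ChardinPhilippon1999] -/
theorem pointDatum_of_datum3_of_farDef (hfarDef : ∀ (ω : Fin 3 → ℂ) (c₁ : ℝ), 1 ≤ c₁ → ∃ δstar : ℕ, 1 ≤ δstar ∧ ∃ K₀ : ℕ, 1 ≤ K₀ ∧ ∃ C₄ : ℝ, c₁ ≤ C₄ ∧ ∃ lam : ℝ, 1 ≤ lam ∧ ∃ c : ℝ, c₁ ≤ c ∧ ∀ Δ Y : ℝ, c ≤ Δ → Δ ≤ Y → ∀ (Q : Rx 3) (a : ℕ) (P : Rx 3) (b : ℕ) (𝔮 : Ideal (Rx 3)) (T : Rx 3) (τ : ℕ) (𝔭 𝔮' : Ideal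 (Rx 3)), CycleAP3Datum ω c₁ Δ (lam * Y) Q a P b 𝔮 T τ 𝔭 → 𝔮'.IsPrime → 𝔮'.IsHomogeneous (homogeneousSubmodule (Fin (3 + 1)) ℚ) → IsUnmixedOfRank 𝔮' 2 → 𝔮' ∈ (Ideal.span {Q} ⊔ Ideal.span {P}).minimalPrimes → Ideal.span {Q} ⊔ Ideal.span {P} ⊔ Ideal.span {T} ≤ 𝔮' → 𝔮' < 𝔭 → δstar < ideg 𝔮' 2 → a + b + ⌊Δ⌋₊ ≤ τ → Module.finrank ℚ ↥(homogeneousSubmodule (Fin (3 + 1)) ℚ τ) < Module.finrank ℚ ↥(homogeneousSubmodule (Fin (3 + 1)) ℚ τ ⊓ 𝔮'.restrictScalars ℚ) + 2 * ⌊Δ⌋₊ * ideg 𝔮 2 → ⌊c₁ * Δ⌋₊ + 1 < ideg 𝔭 1 → ¬ (Module.finrank ℚ ↥(homogeneousSubmodule (Fin (3 + 1)) ℚ ⌊c₁ * Δ⌋₊) = Module.finrank ℚ ↥(homogeneousSubmodule (Fin (3 + 1)) ℚ ⌊c₁ * Δ⌋₊ ⊓ 𝔭.restrictScalars ℚ)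 + ideg 𝔭 1) → homogeneousSubmodule (Fin (3 + 1)) ℚ ⌊C₄ * Δ⌋₊ ⊓ 𝔭.restrictScalars ℚ ≤ 𝔮'.restrictScalars ℚ → K₀ * Module.finrank ℚ ↥(homogeneousSubmodule (Fin (3 + 1)) ℚ ⌊C₄ * Δ⌋₊) < ideg 𝔭 1 + K₀ * Module.finrank ℚ ↥(homogeneousSubmodule (Fin (3 + 1)) ℚ ⌊C₄ * Δ⌋₊ ⊓ 𝔭.restrictScalars ℚ) → ∃ (K : Type) (_ : Field K) (_ : NumberField K) (β : Fin 3 → K) (σ : K →+* ℂ), (Module.finrank ℚ K : ℝ) ≤ (c * Δ) ^ 3 ∧ Height.logHeight (Fin.cons (1 : K) β : Fin (3 + 1) → K) ≤ c * Y * Δ ^ 2 ∧ ‖(fun j => σ (β j)) - ω‖ ≤ Real.exp (-((Δ * Height.logHeight (Fin.cons (1 : K) β : Fin (3 + 1) → K) + Y * Module.finrank ℚ K) / c))) : ∀ (ω : Fin 3 → ℂ) (c₁ : ℝ), 1 ≤ c₁ → ∃ lam : ℝ, 1 ≤ lam ∧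
    ∃ c : ℝ, c₁ ≤ c ∧ ∀ Δ Y : ℝ, c ≤ Δ → Δ ≤ Y →
    ∀ (Q : Rx 3) (a : ℕ) (P : Rx 3) (b : ℕ) (𝔮 : Ideal (Rx 3)) (T : Rx 3) (τ : ℕ)
      (𝔭 : Ideal (Rx 3)), CycleAP3Datum ω c₁ Δ (lam * Y) Q a P b 𝔮 T τ 𝔭 → a + b + ⌊Δ⌋₊ ≤ τ →
    (∀ 𝔮'' ∈ (Ideal.span {Q} ⊔ Ideal.span {P}).minimalPrimes, T ∈ 𝔮'' →
      Module.finrank ℚ ↥(homogeneousSubmodule (Fin (3 + 1)) ℚ τ) <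
        Module.finrank ℚ ↥(homogeneousSubmodule (Fin (3 + 1)) ℚ τ ⊓ 𝔮''.restrictScalars ℚ) +
          2 * ⌊Δ⌋₊ * ideg 𝔮 2) →
    ∃ (K : Type) (_ : Field K) (_ : NumberField K) (β : Fin 3 → K) (σ : K →+* ℂ),
      (Module.finrank ℚ K : ℝ) ≤ (c * Δ) ^ 3 ∧
      Height.logHeight (Fin.cons (1 : K) β : Fin (3 + 1) → K) ≤ c * Y * Δ ^ 2 ∧
      ‖(fun j => σ (β j)) - ω‖ ≤
        Real.exp (-((Δ * Height.logHeight (Fin.cons (1 : K) β : Fin (3 + 1) → K) +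
          Y * Module.finrank ℚ K) / c)) := by
  intro ω c₁ hc₁
  classical
  have hc₁0 : 0 < c₁ := by linarith
  -- the far branch FIRST: it fixes the satellite threshold `δ⋆` and the envelope constant `C₄`
  obtain ⟨δs, hδs1, K₀, hK₀1, C₄, hc₁C₄, lf, hlf1, cf, hcf, hfar⟩ := hfarDef ω c₁ hc₁
  have hC₄1 : 1 ≤ C₄ := hc₁.trans hc₁C₄
  -- the good-transfer constant `c₁g = max c₁ (C₄ + 24)` (level `⌊c₁g Δ⌋ ≥ a + b + τ + ⌊C₄Δ⌋ − 2`)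
  set c₁g : ℝ := max c₁ (C₄ + 24) with hc₁gdef
  have hc₁c₁g : c₁ ≤ c₁g := le_max_left _ _
  have h24 : C₄ + 24 ≤ c₁g := le_max_right _ _
  have hc₁g1 : 1 ≤ c₁g := hc₁.trans hc₁c₁g
  -- the four other branch transfers
  obtain ⟨lg, hlg1, cg, hcg, hgood⟩ := pointDatum_of_clause 3 (by norm_num) stub_zeroDimDictionary
    (stub_sharpClosestPoint stub_orbitClusterBound stub_zeroDimDictionary) ω c₁g hc₁g1
  obtain ⟨ln, hln1, cn, hcn, hnear⟩ := pointDatum_of_nearClause 3 (by norm_num) stub_zeroDimDictionary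
    sharpClosestPointDeficient ω C₄ K₀ hC₄1 hK₀1
  obtain ⟨ll, hll1, cl, hcl, hline⟩ := pointDatum_of_lineSatellite3_log orbitFloorLog
    stub_satelliteHeightLine stub_containerRestart ω c₁ hc₁
  obtain ⟨lb, hlb1, cb, hcb, hbdd⟩ := pointDatum_of_boundedSatellite3 orbitFloorLog
    stub_satelliteHeight stub_containerRestart δs hδs1 ω c₁ hc₁
  have hcg1 : 1 ≤ cg := hc₁g1.trans hcg
  have hcl1 : 1 ≤ cl := hc₁.trans hcl
  have hcb1 : 1 ≤ cb := hc₁.trans hcb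
  have hcf1 : 1 ≤ cf := hc₁.trans hcf
  have hcn1 : 1 ≤ cn := hC₄1.trans hcn
  have hlg0 : 0 < lg := by linarith
  have hln0 : 0 < ln := by linarith
  have hll0 : 0 < ll := by linarith
  have hlb0 : 0 < lb := by linarith
  have hlf0 : 0 < lf := by linarith
  -- per-branch co-boosts (the product of the other four boosts)
  obtain ⟨mg, hmg⟩ : ∃ mg : ℝ, mg = ln * ll * lb * lf := ⟨_, rfl⟩
  obtain ⟨mn, hmn⟩ : ∃ mn : ℝ, mn = lg * ll * lb * lf := ⟨_, rfl⟩
  obtain ⟨ml, hml⟩ : ∃ ml : ℝ, ml = lg * ln * lb * lf := ⟨_, rfl⟩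
  obtain ⟨mb, hmb⟩ : ∃ mb : ℝ, mb = lg * ln * ll * lf := ⟨_, rfl⟩
  obtain ⟨mf, hmf⟩ : ∃ mf : ℝ, mf = lg * ln * ll * lb := ⟨_, rfl⟩
  have h4 : ∀ {p q r s : ℝ}, 1 ≤ p → 1 ≤ q → 1 ≤ r → 1 ≤ s → (1 : ℝ) ≤ p * q * r * s :=
    fun hp hq hr hs => one_le_mul_of_one_le_of_one_le
      (one_le_mul_of_one_le_of_one_le (one_le_mul_of_one_le_of_one_le hp hq) hr) hs
  have hmg1 : 1 ≤ mg := hmg ▸ h4 hln1 hll1 hlb1 hlf1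
  have hmn1 : 1 ≤ mn := hmn ▸ h4 hlg1 hll1 hlb1 hlf1
  have hml1 : 1 ≤ ml := hml ▸ h4 hlg1 hln1 hlb1 hlf1
  have hmb1 : 1 ≤ mb := hmb ▸ h4 hlg1 hln1 hll1 hlf1
  have hmf1 : 1 ≤ mf := hmf ▸ h4 hlg1 hln1 hll1 hlb1
  have hmg0 : 0 ≤ mg := by linarith
  have hmn0 : 0 ≤ mn := by linarith
  have hml0 : 0 ≤ ml := by linarith
  have hmb0 : 0 ≤ mb := by linarith
  have hmf0 : 0 ≤ mf := by linarith
  -- total boost and final constant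
  refine ⟨lg * ln * ll * lb * lf, one_le_mul_of_one_le_of_one_le (h4 hlg1 hln1 hll1 hlb1) hlf1, ?_⟩
  obtain ⟨C, hCdef⟩ : ∃ C : ℝ, C = cg * mg + cn * mn + cl * ml + cb * mb + cf * mf := ⟨_, rfl⟩
  have tg : 0 ≤ cg * mg := by positivity
  have tn : 0 ≤ cn * mn := by positivity
  have tl : 0 ≤ cl * ml := by positivity
  have tb : 0 ≤ cb * mb := by positivity
  have tf : 0 ≤ cf * mf := by positivity
  have hCg : cg * mg ≤ C := by rw [hCdef]; linarith
  have hCn : cn * mn ≤ C := by rw [hCdef]; linarith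
  have hCl : cl * ml ≤ C := by rw [hCdef]; linarith
  have hCb : cb * mb ≤ C := by rw [hCdef]; linarith
  have hCf : cf * mf ≤ C := by rw [hCdef]; linarith
  have hcgC : cg ≤ C := le_trans (le_mul_of_one_le_right (by linarith) hmg1) hCg
  have hcnC : cn ≤ C := le_trans (le_mul_of_one_le_right (by linarith) hmn1) hCn
  have hclC : cl ≤ C := le_trans (le_mul_of_one_le_right (by linarith) hml1) hCl
  have hcbC : cb ≤ C := le_trans (le_mul_of_one_le_right (by linarith) hmb1) hCb
  have hcfC : cf ≤ C := le_trans (le_mul_of_one_le_right (by linarith) hmf1) hCf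
  refine ⟨C, hc₁c₁g.trans (hcg.trans hcgC), ?_⟩
  intro Δ Y hΔ hY Q a P b 𝔮 T τ 𝔭 hd hτab hthin
  have hC1 : 1 ≤ C := hcg1.trans hcgC
  have hΔ1 : 1 ≤ Δ := hC1.trans hΔ
  have hΔ0 : 0 ≤ Δ := by linarith
  have hY0 : 0 ≤ Y := by linarith
  have hcgΔ : cg ≤ Δ := hcgC.trans hΔ
  have hcnΔ : cn ≤ Δ := hcnC.trans hΔ
  have hclΔ : cl ≤ Δ := hclC.trans hΔ
  have hcbΔ : cb ≤ Δ := hcbC.trans hΔ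
  have hcfΔ : cf ≤ Δ := hcfC.trans hΔ
  -- the five per-branch scales `m_x · Y`
  have hYg : Y ≤ mg * Y := le_mul_of_one_le_left hY0 hmg1
  have hYn : Y ≤ mn * Y := le_mul_of_one_le_left hY0 hmn1
  have hYl : Y ≤ ml * Y := le_mul_of_one_le_left hY0 hml1
  have hYb : Y ≤ mb * Y := le_mul_of_one_le_left hY0 hmb1
  have hYf : Y ≤ mf * Y := le_mul_of_one_le_left hY0 hmf1
  have hΔYg : Δ ≤ mg * Y := hY.trans hYg
  have hΔYn : Δ ≤ mn * Y := hY.trans hYn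
  have hΔYl : Δ ≤ ml * Y := hY.trans hYl
  have hΔYb : Δ ≤ mb * Y := hY.trans hYb
  have hΔYf : Δ ≤ mf * Y := hY.trans hYf
  have eg : lg * ln * ll * lb * lf * Y = lg * (mg * Y) := by rw [hmg]; ring
  have en : lg * ln * ll * lb * lf * Y = ln * (mn * Y) := by rw [hmn]; ring
  have el : lg * ln * ll * lb * lf * Y = ll * (ml * Y) := by rw [hml]; ring
  have eb : lg * ln * ll * lb * lf * Y = lb * (mb * Y) := by rw [hmb]; ring
  have ef : lg * ln * ll * lb * lf * Y = lf * (mf * Y) := by rw [hmf]; ring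
  -- unpack the datum (keeping a folded copy for the far branch)
  have hdfull := hd
  obtain ⟨hQ0, hQa, ha1, haΔ, hQp, hPb, hb1, hbΔ, hPQ, h𝔮p, h𝔮h, h𝔮u, hQ𝔮, hP𝔮, -, -, -, hTτ, hτ1,
    hτΔ, hT𝔮, h𝔭p, h𝔭h, h𝔭u, h𝔮𝔭, hT𝔭, -, hdeg, hht, habs⟩ := hd
  have hspan : Ideal.span {Q} ⊔ Ideal.span {P} ⊔ Ideal.span {T} ≤ 𝔭 :=
    sup_le (sup_le ((Ideal.span_singleton_le_iff_mem _).mpr (h𝔮𝔭 hQ𝔮))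
      ((Ideal.span_singleton_le_iff_mem _).mpr (h𝔮𝔭 hP𝔮)))
      ((Ideal.span_singleton_le_iff_mem _).mpr hT𝔭)
  -- (G): the good transfer at constant `c₁g`, given the clause at level `⌊c₁g Δ⌋`
  have good : Module.finrank ℚ ↥(homogeneousSubmodule (Fin (3 + 1)) ℚ ⌊c₁g * Δ⌋₊) =
      Module.finrank ℚ ↥(homogeneousSubmodule (Fin (3 + 1)) ℚ ⌊c₁g * Δ⌋₊ ⊓ 𝔭.restrictScalars ℚ) +
        ideg 𝔭 1 →
      ∃ (K : Type) (_ : Field K) (_ : NumberField K) (β : Fin 3 → K) (σ : K →+* ℂ),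
        (Module.finrank ℚ K : ℝ) ≤ (C * Δ) ^ 3 ∧
        Height.logHeight (Fin.cons (1 : K) β : Fin (3 + 1) → K) ≤ C * Y * Δ ^ 2 ∧
        ‖(fun j => σ (β j)) - ω‖ ≤
          Real.exp (-((Δ * Height.logHeight (Fin.cons (1 : K) β : Fin (3 + 1) → K) +
            Y * Module.finrank ℚ K) / C)) := by
    intro hcl'
    have hY' : 0 ≤ lg * (mg * Y) := by positivity
    obtain ⟨hdeg', hht', habs'⟩ := orbitBounds_mono (𝔭 := 𝔭) (ω := ω) hc₁ hc₁c₁g hΔ0 hY'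
      hdeg (by rw [← eg]; exact hht) (by rw [← eg]; exact habs)
    have hdat := hgood Δ (mg * Y) hcgΔ hΔYg 𝔭 h𝔭p h𝔭h h𝔭u hdeg'
      (by simpa [mul_comm, mul_left_comm, mul_assoc] using hht')
      (by simpa [mul_comm, mul_left_comm, mul_assoc] using habs') hcl'
    exact datum_mono hcg1 hcgC hΔ0 hY0 hYg
      (by calc cg * (mg * Y) = cg * mg * Y := by ring
          _ ≤ C * Y := mul_le_mul_of_nonneg_right hCg hY0) hdat
  by_cases hclause : Module.finrank ℚ ↥(homogeneousSubmodule (Fin (3 + 1)) ℚ ⌊c₁ * Δ⌋₊) =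
      Module.finrank ℚ ↥(homogeneousSubmodule (Fin (3 + 1)) ℚ ⌊c₁ * Δ⌋₊ ⊓ 𝔭.restrictScalars ℚ) +
        ideg 𝔭 1
  · -- (G) the clause at `⌊c₁Δ⌋`, hence at `⌊c₁g Δ⌋`
    exact good (clause_mono_level 3 𝔭 h𝔭p h𝔭h h𝔭u _ _
      (Nat.floor_le_floor (mul_le_mul_of_nonneg_right hc₁c₁g hΔ0)) hclause)
  · -- (¬G): the orbit is long
    have hlong : ⌊c₁ * Δ⌋₊ + 1 < ideg 𝔭 1 := by
      by_contra hsh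
      exact hclause (rankOne_interpolation_of_ideg_le 3 𝔭 _ h𝔭p h𝔭h h𝔭u (not_lt.mp hsh))
    by_cases hnc : ideg 𝔭 1 + K₀ * Module.finrank ℚ
        ↥(homogeneousSubmodule (Fin (3 + 1)) ℚ ⌊C₄ * Δ⌋₊ ⊓ 𝔭.restrictScalars ℚ) ≤
        K₀ * Module.finrank ℚ ↥(homogeneousSubmodule (Fin (3 + 1)) ℚ ⌊C₄ * Δ⌋₊)
    · -- (N) the NEAR-clause at level `⌊C₄Δ⌋`: the deficient lever's transfer at constant `C₄`, scale `(Δ, mn Y)`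
      have hY' : 0 ≤ ln * (mn * Y) := by positivity
      obtain ⟨hdeg', hht', habs'⟩ := orbitBounds_mono (𝔭 := 𝔭) (ω := ω) hc₁ hc₁C₄ hΔ0 hY'
        hdeg (by rw [← en]; exact hht) (by rw [← en]; exact habs)
      have hdat := hnear Δ (mn * Y) hcnΔ hΔYn 𝔭 h𝔭p h𝔭h h𝔭u hdeg'
        (by simpa [mul_comm, mul_left_comm, mul_assoc] using hht')
        (by simpa [mul_comm, mul_left_comm, mul_assoc] using habs') hnc
      exact datum_mono hcn1 hcnC hΔ0 hY0 hYn
        (by calc cn * (mn * Y) = cn * mn * Y := by ring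
            _ ≤ C * Y := mul_le_mul_of_nonneg_right hCn hY0) hdat
    -- (¬N): the orbit is DEFICIENT at level `⌊C₄Δ⌋`
    have hdefic : K₀ * Module.finrank ℚ ↥(homogeneousSubmodule (Fin (3 + 1)) ℚ ⌊C₄ * Δ⌋₊) <
        ideg 𝔭 1 + K₀ * Module.finrank ℚ
          ↥(homogeneousSubmodule (Fin (3 + 1)) ℚ ⌊C₄ * Δ⌋₊ ⊓ 𝔭.restrictScalars ℚ) := not_le.mp hnc
    -- the envelope level `ν₄ = ⌊C₄ Δ⌋ ≥ 1`
    have hC₄Δ : (1 : ℝ) ≤ C₄ * Δ := one_le_mul_of_one_le_of_one_le hC₄1 hΔ1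
    have hν₄1 : 1 ≤ ⌊C₄ * Δ⌋₊ := Nat.le_floor (by exact_mod_cast hC₄Δ)
    rcases fourthForm_or_enveloped Q P T a b τ hQ0 hQa hPb hTτ ha1 hb1 hτ1 hQp hPQ 𝔭 h𝔭p h𝔭h
      h𝔭u hspan ⌊C₄ * Δ⌋₊ with ⟨g, hgν, hg𝔭, hmin4⟩ | ⟨𝔮', h𝔮'p, h𝔮'h, h𝔮'u, h𝔮'min, h𝔮'le, h𝔮'lt, henv⟩
    · -- (CP4) an isolated point of FOUR hypersurfaces: Chardin–Philippon at level `⌊c₁g Δ⌋`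
      refine good (clause_of_fourthForm Q P T g a b τ ⌊C₄ * Δ⌋₊ hQa hPb hTτ hgν ha1 hb1 hτ1 hν₄1
        𝔭 h𝔭p h𝔭h h𝔭u hmin4 _ ?_)
      -- `a + b + τ + ⌊C₄Δ⌋ + 1 ≤ ⌊c₁g Δ⌋ + 3` from `a + b + τ ≤ 8Δ` and `c₁g ≥ C₄ + 24`
      have h8 : (a : ℝ) + b + τ ≤ 8 * Δ := by linarith only [haΔ, hbΔ, hτΔ]
      have hν₄ : (⌊C₄ * Δ⌋₊ : ℝ) ≤ C₄ * Δ := Nat.floor_le (by positivity)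
      have h1 : c₁g * Δ - 1 < ⌊c₁g * Δ⌋₊ := Nat.sub_one_lt_floor (c₁g * Δ)
      have h2 : (C₄ + 24) * Δ ≤ c₁g * Δ := mul_le_mul_of_nonneg_right h24 hΔ0
      have : ((a + b + τ + ⌊C₄ * Δ⌋₊ + 1 : ℕ) : ℝ) ≤ ((⌊c₁g * Δ⌋₊ + 3 : ℕ) : ℝ) := by
        push_cast; nlinarith only [h8, hν₄, h1, h2, hΔ1]
      exact_mod_cast this
    · -- (ENV) a satellite `𝔮'` enveloping the orbit: `Q, P, T ∈ 𝔮'`, `𝔮' ≤ 𝔭`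
      have hQ𝔮' : Q ∈ 𝔮' := h𝔮'le (Ideal.mem_sup_left (Ideal.mem_sup_left (Ideal.mem_span_singleton_self Q)))
      have hP𝔮' : P ∈ 𝔮' := h𝔮'le (Ideal.mem_sup_left (Ideal.mem_sup_right (Ideal.mem_span_singleton_self P)))
      have hab : (a : ℝ) + b ≤ 3 * Δ := by linarith only [haΔ, hbΔ]
      by_cases hlineCase : ideg 𝔮' 2 = 1
      · -- (L) line satellite: log floor + restart, at the scale `(Δ, ml Y)`
        have hdat := hline Δ (ml * Y) hclΔ hΔYl Q a P b 𝔮' 𝔭 hQ0 hQa hPb ha1 hb1 hab hQp hPQ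
          h𝔮'p h𝔮'h h𝔮'u hQ𝔮' hP𝔮' hlineCase h𝔭p h𝔭h h𝔭u h𝔮'lt.le hlong hdeg
          (by rw [← el]; exact hht) (by rw [← el]; exact habs)
        exact datum_mono hcl1 hclC hΔ0 hY0 hYl
          (by calc cl * (ml * Y) = cl * ml * Y := by ring
              _ ≤ C * Y := mul_le_mul_of_nonneg_right hCl hY0) hdat
      · by_cases hbddCase : ideg 𝔮' 2 ≤ δs
        · -- (B) bounded-degree satellite: log floor + satellite height + restart, scale `(Δ, mb Y)`
          have hdat := hbdd Δ (mb * Y) hcbΔ hΔYb Q a P b 𝔮' 𝔭 hQ0 hQa hPb ha1 hb1 hab hQp hPQ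
            h𝔮'p h𝔮'h h𝔮'u hQ𝔮' hP𝔮' hbddCase h𝔭p h𝔭h h𝔭u h𝔮'lt.le hlong hdeg
            (by rw [← eb]; exact hht) (by rw [← eb]; exact habs)
          exact datum_mono hcb1 hcbC hΔ0 hY0 hYb
            (by calc cb * (mb * Y) = cb * mb * Y := by ring
                _ ≤ C * Y := mul_le_mul_of_nonneg_right hCb hY0) hdat
        · -- (F) far enveloping satellite (degree `> δ⋆`): the open kernel, at the scale `(Δ, mf Y)`
          have hfarCase : δs < ideg 𝔮' 2 := not_le.mp hbddCase
          have hd' : CycleAP3Datum ω c₁ Δ (lf * (mf * Y)) Q a P b 𝔮 T τ 𝔭 := by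
            rw [← ef]; exact hdfull
          have hT𝔮' : T ∈ 𝔮' := h𝔮'le (Ideal.mem_sup_right (Ideal.mem_span_singleton_self T))
          have hdat := hfar Δ (mf * Y) hcfΔ hΔYf Q a P b 𝔮 T τ 𝔭 𝔮' hd' h𝔮'p h𝔮'h h𝔮'u h𝔮'min
            h𝔮'le h𝔮'lt hfarCase hτab (hthin 𝔮' h𝔮'min hT𝔮') hlong hclause henv hdefic
          exact datum_mono hcf1 hcfC hΔ0 hY0 hYf
            (by calc cf * (mf * Y) = cf * mf * Y := by ring
                _ ≤ C * Y := mul_le_mul_of_nonneg_right hCf hY0) hdat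

/-- **`PointAPAbsAt 3` from the far deficient kernel alone** — Philippon's AP2 for `n = 3` with
pointwise constants, assembled from the thin clause-free descent with its data (`cycleAP3DataThin`,
p137055/p135212) run at the boosted scale `(Δ, λY)` and the transfer `pointDatum_of_datum3_of_farDef`.
[cite: NesterenkoPhilippon2001, Ch. 4 §4 p. 61] -/
theorem pointAPAt3_of_farDef (hfarDef : ∀ (ω : Fin 3 → ℂ) (c₁ : ℝ), 1 ≤ c₁ → ∃ δstar : ℕ, 1 ≤ δstar ∧ ∃ K₀ : ℕ, 1 ≤ K₀ ∧ ∃ C₄ : ℝ, c₁ ≤ C₄ ∧ ∃ lam : ℝ, 1 ≤ lam ∧ ∃ c : ℝ, c₁ ≤ c ∧ ∀ Δ Y : ℝ, c ≤ Δ → Δ ≤ Y → ∀ (Q : Rx 3) (a : ℕ) (P : Rx 3) (b : ℕ) (𝔮 : Ideal (Rx 3)) (T : Rx 3) (τ : ℕ) (𝔭 𝔮' : Ideal (Rx 3)), CycleAP3Datum ω c₁ Δ (lam * Y) Q a P b 𝔮 T τ 𝔭 → 𝔮'.IsPrime → 𝔮'.IsHomogeneous (homogeneousSubmodule (Fin (3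 + 1)) ℚ) → IsUnmixedOfRank 𝔮' 2 → 𝔮' ∈ (Ideal.span {Q} ⊔ Ideal.span {P}).minimalPrimes → Ideal.span {Q} ⊔ Ideal.span {P} ⊔ Ideal.span {T} ≤ 𝔮' → 𝔮' < 𝔭 → δstar < ideg 𝔮' 2 → a + b + ⌊Δ⌋₊ ≤ τ → Module.finrank ℚ ↥(homogeneousSubmodule (Fin (3 + 1)) ℚ τ) < Module.finrank ℚ ↥(homogeneousSubmodule (Fin (3 + 1)) ℚ τ ⊓ 𝔮'.restrictScalars ℚ) + 2 * ⌊Δ⌋₊ * ideg 𝔮 2 → ⌊c₁ * Δ⌋₊ + 1 < ideg 𝔭 1 → ¬ (Module.finrank ℚ ↥(homogeneousSubmodule (Fin (3 + 1)) ℚ ⌊c₁ * Δ⌋₊) = Module.finrank ℚ ↥(homogeneousSubmodule (Fin (3 + 1)) ℚ ⌊c₁ * Δ⌋₊ ⊓ 𝔭.restrictScalars ℚ) + ideg 𝔭 1) → homogeneousSubmodule (Fin (3 + 1)) ℚ ⌊C₄ * Δ⌋₊ ⊓ 𝔭.restrictScalars ℚ ≤ 𝔮'.restrictScalars ℚ →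 K₀ * Module.finrank ℚ ↥(homogeneousSubmodule (Fin (3 + 1)) ℚ ⌊C₄ * Δ⌋₊) < ideg 𝔭 1 + K₀ * Module.finrank ℚ ↥(homogeneousSubmodule (Fin (3 + 1)) ℚ ⌊C₄ * Δ⌋₊ ⊓ 𝔭.restrictScalars ℚ) → ∃ (K : Type) (_ : Field K) (_ : NumberField K) (β : Fin 3 → K) (σ : K →+* ℂ), (Module.finrank ℚ K : ℝ) ≤ (c * Δ) ^ 3 ∧ Height.logHeight (Fin.cons (1 : K) β : Fin (3 + 1) → K) ≤ c * Y * Δ ^ 2 ∧ ‖(fun j => σ (β j)) - ω‖ ≤ Real.exp (-((Δ * Height.logHeight (Fin.cons (1 : K) β : Fin (3 + 1) → K) + Y * Module.finrank ℚ K) / c))) :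
    PointAPAbsAt 3 := by
  intro ω
  classical
  obtain ⟨c₀, hc₀1, hdata⟩ := cycleAP3DataThin ω
  obtain ⟨lam, hlam1, c, hc, htrans⟩ := pointDatum_of_datum3_of_farDef hfarDef ω c₀ hc₀1
  have hc1 : 1 ≤ c := hc₀1.trans hc
  refine ⟨c, hc1, fun Δ Y hΔ hY => ?_⟩
  have hY0 : 0 ≤ Y := by linarith [hc1.trans hΔ]
  have hΔY' : Δ ≤ lam * Y := hY.trans (le_mul_of_one_le_left hY0 hlam1)
  obtain ⟨Q, a, P, b, 𝔮, T, τ, 𝔭, hd, hτab, hthin⟩ := hdata Δ (lam * Y) (hc.trans hΔ) hΔY'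
  exact htrans Δ Y hΔ hY Q a P b 𝔮 T τ 𝔭 hd hτab hthin

/-- **Registered sub-goal `slice_three_of_farDef` — the `t = 3` slice of the crux from the far
deficient kernel alone**: the approximation property for EVERY `θ ∈ ℂ^ι` with `trdeg_ℚ ℚ(θ) ≤ 3`, all
scales, output-dependent accuracy (NOT in print), via `pointAPAt3_of_farDef`, the landed `t ≤ 2` point
properties and the landed lifting `stub_lift`.
[cite: NesterenkoPhilippon2001, Ch. 4 §4 p. 61; LaurentRoy1999, Thm 1] -/
theorem slice_three_of_farDef : (∀ (ω : Fin 3 → ℂ) (c₁ : ℝ), 1 ≤ c₁ → ∃ δstar : ℕ, 1 ≤ δstar ∧ ∃ K₀ : ℕ, 1 ≤ K₀ ∧ ∃ C₄ : ℝ, c₁ ≤ C₄ ∧ ∃ lam : ℝ, 1 ≤ lam ∧ ∃ c : ℝ, c₁ ≤ c ∧ ∀ Δ Y : ℝ, c ≤ Δ → Δ ≤ Y → ∀ (Q : Rx 3) (a : ℕ) (P : Rx 3) (b : ℕ) (𝔮 : Ideal (Rx 3)) (T : Rx 3) (τ : ℕ) (𝔭 𝔮' : Ideal (Rx 3)), CycleAP3Datum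 ω c₁ Δ (lam * Y) Q a P b 𝔮 T τ 𝔭 → 𝔮'.IsPrime → 𝔮'.IsHomogeneous (homogeneousSubmodule (Fin (3 + 1)) ℚ) → IsUnmixedOfRank 𝔮' 2 → 𝔮' ∈ (Ideal.span {Q} ⊔ Ideal.span {P}).minimalPrimes → Ideal.span {Q} ⊔ Ideal.span {P} ⊔ Ideal.span {T} ≤ 𝔮' → 𝔮' < 𝔭 → δstar < ideg 𝔮' 2 → a + b + ⌊Δ⌋₊ ≤ τ → Module.finrank ℚ ↥(homogeneousSubmodule (Fin (3 + 1)) ℚ τ) < Module.finrank ℚ ↥(homogeneousSubmodule (Fin (3 + 1)) ℚ τ ⊓ 𝔮'.restrictScalars ℚ) + 2 * ⌊Δ⌋₊ * ideg 𝔮 2 → ⌊c₁ * Δ⌋₊ + 1 < ideg 𝔭 1 → ¬ (Module.finrank ℚ ↥(homogeneousSubmodule (Fin (3 + 1)) ℚ ⌊c₁ * Δ⌋₊) = Module.finrank ℚ ↥(homogeneousSubmodule (Fin (3 + 1)) ℚ ⌊c₁ * Δ⌋₊ ⊓ 𝔭.restrictScalars ℚ) + ideg 𝔭 1) → homogeneousSubmodule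 (Fin (3 + 1)) ℚ ⌊C₄ * Δ⌋₊ ⊓ 𝔭.restrictScalars ℚ ≤ 𝔮'.restrictScalars ℚ → K₀ * Module.finrank ℚ ↥(homogeneousSubmodule (Fin (3 + 1)) ℚ ⌊C₄ * Δ⌋₊) < ideg 𝔭 1 + K₀ * Module.finrank ℚ ↥(homogeneousSubmodule (Fin (3 + 1)) ℚ ⌊C₄ * Δ⌋₊ ⊓ 𝔭.restrictScalars ℚ) → ∃ (K : Type) (_ : Field K) (_ : NumberField K) (β : Fin 3 → K) (σ : K →+* ℂ), (Module.finrank ℚ K : ℝ) ≤ (c * Δ) ^ 3 ∧ Height.logHeight (Fin.cons (1 : K) β : Fin (3 + 1) → K) ≤ c * Y * Δ ^ 2 ∧ ‖(fun j => σ (β j)) - ω‖ ≤ Real.exp (-((Δ * Height.logHeight (Fin.cons (1 : K) β : Fin (3 + 1) → K) + Y * Module.finrank ℚ K) / c))) → PointwiseAPSlice 3 := by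
  intro hfarDef
  exact stub_lift 3 (by norm_num) fun t₀ h₀ h₀3 =>
    if h₂ : t₀ ≤ 2 then PointAPThreeConditional.pointAP_le_two t₀ h₀ h₂
    else (show t₀ = 3 by omega) ▸ pointAPAt3_of_farDef hfarDef

/-- The point property in every dimension `t ≥ 3` from the far deficient kernel and the `t ≥ 4` point
property (Philippon's conjecture, taken as a hypothesis). -/
theorem pointAP_three_le_of_farDef (hfarDef : ∀ (ω : Fin 3 → ℂ) (c₁ : ℝ), 1 ≤ c₁ → ∃ δstar : ℕ, 1 ≤ δstar ∧ ∃ K₀ : ℕ, 1 ≤ K₀ ∧ ∃ C₄ : ℝ, c₁ ≤ C₄ ∧ ∃ lam : ℝ, 1 ≤ lam ∧ ∃ c : ℝ, c₁ ≤ c ∧ ∀ Δ Y : ℝ, c ≤ Δ → Δ ≤ Y → ∀ (Q : Rx 3) (a : ℕ) (P : Rx 3) (b : ℕ) (𝔮 : Ideal (Rx 3)) (T : Rx 3) (τ : ℕ) (𝔭 𝔮' : Ideal (Rx 3)), CycleAP3Datum ω c₁ Δ (lam * Y) Q a P b 𝔮 T τ 𝔭 → 𝔮'.IsPrime → 𝔮'.IsHomogeneous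 (homogeneousSubmodule (Fin (3 + 1)) ℚ) → IsUnmixedOfRank 𝔮' 2 → 𝔮' ∈ (Ideal.span {Q} ⊔ Ideal.span {P}).minimalPrimes → Ideal.span {Q} ⊔ Ideal.span {P} ⊔ Ideal.span {T} ≤ 𝔮' → 𝔮' < 𝔭 → δstar < ideg 𝔮' 2 → a + b + ⌊Δ⌋₊ ≤ τ → Module.finrank ℚ ↥(homogeneousSubmodule (Fin (3 + 1)) ℚ τ) < Module.finrank ℚ ↥(homogeneousSubmodule (Fin (3 + 1)) ℚ τ ⊓ 𝔮'.restrictScalars ℚ) + 2 * ⌊Δ⌋₊ * ideg 𝔮 2 → ⌊c₁ * Δ⌋₊ + 1 < ideg 𝔭 1 → ¬ (Module.finrank ℚ ↥(homogeneousSubmodule (Fin (3 + 1)) ℚ ⌊c₁ * Δ⌋₊) = Module.finrank ℚ ↥(homogeneousSubmodule (Fin (3 + 1)) ℚ ⌊c₁ * Δ⌋₊ ⊓ 𝔭.restrictScalars ℚ) + ideg 𝔭 1) → homogeneousSubmodule (Fin (3 + 1)) ℚ ⌊C₄ * Δ⌋₊ ⊓ 𝔭.restrictScalars ℚ ≤ 𝔮'.restrictScalars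 ℚ → K₀ * Module.finrank ℚ ↥(homogeneousSubmodule (Fin (3 + 1)) ℚ ⌊C₄ * Δ⌋₊) < ideg 𝔭 1 + K₀ * Module.finrank ℚ ↥(homogeneousSubmodule (Fin (3 + 1)) ℚ ⌊C₄ * Δ⌋₊ ⊓ 𝔭.restrictScalars ℚ) → ∃ (K : Type) (_ : Field K) (_ : NumberField K) (β : Fin 3 → K) (σ : K →+* ℂ), (Module.finrank ℚ K : ℝ) ≤ (c * Δ) ^ 3 ∧ Height.logHeight (Fin.cons (1 : K) β : Fin (3 + 1) → K) ≤ c * Y * Δ ^ 2 ∧ ‖(fun j => σ (β j)) - ω‖ ≤ Real.exp (-((Δ * Height.logHeight (Fin.cons (1 : K) β : Fin (3 + 1) → K) + Y * Module.finrank ℚ K) / c)))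
    (h4 : ∀ t : ℕ, 4 ≤ t → PointAPAbsAt t) : ∀ t : ℕ, 3 ≤ t → PointAPAbsAt t := fun t ht =>
  if e₃ : t = 3 then e₃ ▸ pointAPAt3_of_farDef hfarDef else h4 t (by omega)

/-- **Registered sub-goal `approximationProperty_of_farDef` — the crux's exact residual after v21–v23**:
`ApproximationProperty` (all `θ`, all `t ≥ 1` with `trdeg_ℚ ℚ(θ) ≤ t`) from the far deficient kernel
at `n = 3` and the point property `PointAPAbsAt t` for `t ≥ 4` (Philippon's conjecture AP1/AP2,
`n ≥ 4`), everything else being in the tree (`approximationProperty_of_pointAP_three_le`, p130702).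
[cite: NesterenkoPhilippon2001, Ch. 4 §4 p. 61] -/
theorem approximationProperty_of_farDef : (∀ (ω : Fin 3 → ℂ) (c₁ : ℝ), 1 ≤ c₁ → ∃ δstar : ℕ, 1 ≤ δstar ∧ ∃ K₀ : ℕ, 1 ≤ K₀ ∧ ∃ C₄ : ℝ, c₁ ≤ C₄ ∧ ∃ lam : ℝ, 1 ≤ lam ∧ ∃ c : ℝ, c₁ ≤ c ∧ ∀ Δ Y : ℝ, c ≤ Δ → Δ ≤ Y → ∀ (Q : Rx 3) (a : ℕ) (P : Rx 3) (b : ℕ) (𝔮 : Ideal (Rx 3)) (T : Rx 3) (τ : ℕ) (𝔭 𝔮' : Ideal (Rx 3)), CycleAP3Datum ω c₁ Δ (lam * Y) Q a P b 𝔮 T τ 𝔭 → 𝔮'.IsPrime → 𝔮'.IsHomogeneous (homogeneousSubmodule (Fin (3 + 1)) ℚ) → IsUnmixedOfRank 𝔮' 2 → 𝔮' ∈ (Ideal.span {Q} ⊔ Ideal.span {P}).minimalPrimes → Ideal.span {Q} ⊔ Ideal.span {P} ⊔ Ideal.span {T} ≤ 𝔮' → 𝔮' < 𝔭 → δstar <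 ideg 𝔮' 2 → a + b + ⌊Δ⌋₊ ≤ τ → Module.finrank ℚ ↥(homogeneousSubmodule (Fin (3 + 1)) ℚ τ) < Module.finrank ℚ ↥(homogeneousSubmodule (Fin (3 + 1)) ℚ τ ⊓ 𝔮'.restrictScalars ℚ) + 2 * ⌊Δ⌋₊ * ideg 𝔮 2 → ⌊c₁ * Δ⌋₊ + 1 < ideg 𝔭 1 → ¬ (Module.finrank ℚ ↥(homogeneousSubmodule (Fin (3 + 1)) ℚ ⌊c₁ * Δ⌋₊) = Module.finrank ℚ ↥(homogeneousSubmodule (Fin (3 + 1)) ℚ ⌊c₁ * Δ⌋₊ ⊓ 𝔭.restrictScalars ℚ) + ideg 𝔭 1) → homogeneousSubmodule (Fin (3 + 1)) ℚ ⌊C₄ * Δ⌋₊ ⊓ 𝔭.restrictScalars ℚ ≤ 𝔮'.restrictScalars ℚ → K₀ * Module.finrank ℚ ↥(homogeneousSubmodule (Fin (3 + 1)) ℚ ⌊C₄ * Δ⌋₊) < ideg 𝔭 1 + K₀ * Module.finrank ℚ ↥(homogeneousSubmodule (Fin (3 + 1)) ℚ ⌊C₄ * Δ⌋₊ ⊓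 𝔭.restrictScalars ℚ) → ∃ (K : Type) (_ : Field K) (_ : NumberField K) (β : Fin 3 → K) (σ : K →+* ℂ), (Module.finrank ℚ K : ℝ) ≤ (c * Δ) ^ 3 ∧ Height.logHeight (Fin.cons (1 : K) β : Fin (3 + 1) → K) ≤ c * Y * Δ ^ 2 ∧ ‖(fun j => σ (β j)) - ω‖ ≤ Real.exp (-((Δ * Height.logHeight (Fin.cons (1 : K) β : Fin (3 + 1) → K) + Y * Module.finrank ℚ K) / c))) → (∀ t : ℕ, 4 ≤ t → PointAPAbsAt t) → ApproximationProperty := by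
  intro hfarDef h4
  exact approximationProperty_of_pointAP_three_le (pointAP_three_le_of_farDef hfarDef h4)

end

end Summit.Schanuel.Schanuel.Cruxes.ApproximationProperty.OrbitInterpolationDeterminant
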